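import Literature.Computability.Complexity.GateEliminationRewire
import Literature.Computability.Complexity.GateEliminationXorMap
import Literature.Computability.Complexity.GateEliminationNormalize
import Literature.Computability.Complexity.GateEliminationTroubledPair

/-!
# Gate elimination: re-gating one gate; Rule 4 (useless gates); single-input dependence

`regate`: replace the function and the two wires of one gate `Q`, keeping everything else —
admissible when the new wires respect the decomposition (xor-part closed and ⊕-type, acyclic
part acyclic for every rank function of `C`). Two regimes preserve fairness and the computed
function: (a) the new equation of `Q` is equivalent to the old one given the other equations
(pointwise, any `Q`); (b) `Q` lies in the acyclic part and every solution of `C` satisfies the new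
equation.

Applications.
* **Rule 4** (Li–Yang §3.3): "A gate is called useless if it is a `1`-gate with only descendant
  `Q`, such that another input of `Q` also feeds `G`. We may eliminate `G` and rewire the nodes
  feeding it to feed `Q`" — `rule4` (regime (a); `G` and `Q` in either part; `Δμ ≥ 1 - 2α_φ`).
* **Case 0.3, second half** (§4.1): "if there is a gate `G` fed by `I₁` and `I₂` that computes a
  function that only depends on `I₁`, we rewire the circuit such that `G` is fed by `I₁` and a
  constant `0` …, so that `G` can be removed by Rule 3" — `eliminate_single_dependence` (regime
  (b), `G` in the acyclic part; `Δμ ≥ 1 - 2α_φ`).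

## References

* J. Li, T. Yang, *3.1n − o(n) circuit lower bounds for explicit functions*, STOC 2022;
  ECCC TR21-023, §3.3 (Rule 4), Lemma 3.11, §4.1 (Case 0.3).
-/

namespace Literature.Computability.Complexity

open Finset

namespace Semicircuit

variable {n : ℕ} (C : Semicircuit n)

/-- `ρ` is a rank function of `C`: it increases strictly along the wires between gates of the
acyclic part. [cite: LiYang2022, Def. 2.5] -/
def IsRank (ρ : Fin C.m → ℕ) : Prop :=
  ∀ j, j ∉ C.xorPart → ∀ (a : Fin 2) (k : Fin C.m), C.arg j a = .gate k → k ∉ C.xorPart → ρ k < ρ j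

/-- `C` has a rank function. [cite: LiYang2022, Def. 2.5] -/
theorem exists_isRank : ∃ ρ, C.IsRank ρ := C.acyclic

/-- Admissible new wires for gate `Q`: in the xor-part, an ⊕-type function and gate wires in the
xor-part; in the acyclic part, gate wires of the acyclic part of smaller rank for every rank
function. [cite: LiYang2022, Def. 2.5] -/
def RegateOK (Q : Fin C.m) (op' : Bool → Bool → Bool) (args' : Fin 2 → Node n C.m) : Prop :=
  (Q ∈ C.xorPart → IsXorOp op' ∧ ∀ (a : Fin 2) (k : Fin C.m), args' a = .gate k → k ∈ C.xorPart) ∧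
  (Q ∉ C.xorPart → ∀ (a : Fin 2) (k : Fin C.m), args' a = .gate k → k ∉ C.xorPart →
    ∀ ρ, C.IsRank ρ → ρ k < ρ Q)

/-- **Re-gating**: replace the function and the wires of the gate `Q`. [folklore] -/
abbrev regate (Q : Fin C.m) (op' : Bool → Bool → Bool) (args' : Fin 2 → Node n C.m)
    (h : C.RegateOK Q op' args') : Semicircuit n where
  m := C.m
  op k := if k = Q then op' else C.op k
  arg k a := if k = Q then args' a else C.arg k a
  out := C.out
  xorPart := C.xorPart
  isXorOp_of_mem k hk := by
    by_cases hkQ : k = Q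
    · rw [if_pos hkQ]; exact (h.1 (hkQ ▸ hk)).1
    · rw [if_neg hkQ]; exact C.isXorOp_of_mem k hk
  mem_of_arg_eq k hk a k' hk' := by
    by_cases hkQ : k = Q
    · rw [if_pos hkQ] at hk'; exact (h.1 (hkQ ▸ hk)).2 a k' hk'
    · rw [if_neg hkQ] at hk'; exact C.mem_of_arg_eq k hk a k' hk'
  acyclic := by
    obtain ⟨ρ, hρ⟩ := C.acyclic
    refine ⟨ρ, fun k hk a k' hk' hK' => ?_⟩
    by_cases hkQ : k = Q
    · rw [if_pos hkQ] at hk'; subst hkQ; exact h.2 hk a k' hk' hK' ρ hρ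
    · rw [if_neg hkQ] at hk'; exact hρ k hk a k' hk' hK'

section Regate

variable (Q : Fin C.m) (op' : Bool → Bool → Bool) (args' : Fin 2 → Node n C.m) (h : C.RegateOK Q op' args')

/-- Wires after re-gating. [folklore] -/
theorem regate_arg (k : Fin C.m) (a : Fin 2) :
    (C.regate Q op' args' h).arg k a = if k = Q then args' a else C.arg k a := rfl

/-- Wires of the other gates. [folklore] -/
theorem regate_arg_of_ne {k : Fin C.m} (hk : k ≠ Q) (a : Fin 2) : (C.regate Q op' args' h).arg k a = C.arg k a := by
  rw [regate_arg, if_neg hk]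

/-- Wires of `Q`. [folklore] -/
theorem regate_arg_self (a : Fin 2) : (C.regate Q op' args' h).arg Q a = args' a := by
  rw [regate_arg, if_pos rfl]

/-- Functions of the other gates. [folklore] -/
theorem regate_op_of_ne {k : Fin C.m} (hk : k ≠ Q) : (C.regate Q op' args' h).op k = C.op k := by
  show (if k = Q then op' else C.op k) = _; rw [if_neg hk]

/-- Function of `Q`. [folklore] -/
theorem regate_op_self : (C.regate Q op' args' h).op Q = op' := by
  show (if Q = Q then op' else C.op Q) = _; rw [if_pos rfl]

/-- Node values are computed by the same function. [folklore] -/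
theorem nodeVal_regate_eq (x : Fin n → Bool) (w : Fin C.m → Bool) (u : Node n C.m) :
    (C.regate Q op' args' h).nodeVal x w u = C.nodeVal x w u := by
  cases u <;> rfl

/-- The equations of the other gates are unchanged. [folklore] -/
theorem gateEq_regate_iff_of_ne (x : Fin n → Bool) (w : Fin C.m → Bool) {k : Fin C.m} (hk : k ≠ Q) :
    (C.regate Q op' args' h).GateEq x w k ↔ C.GateEq x w k := by
  unfold GateEq
  rw [nodeVal_regate_eq, nodeVal_regate_eq, regate_arg_of_ne _ _ _ _ _ hk, regate_arg_of_ne _ _ _ _ _ hk,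
    regate_op_of_ne _ _ _ _ _ hk]

/-- The new equation of `Q`. [folklore] -/
theorem gateEq_regate_self_iff (x : Fin n → Bool) (w : Fin C.m → Bool) :
    (C.regate Q op' args' h).GateEq x w Q ↔ w Q = op' (C.nodeVal x w (args' 0)) (C.nodeVal x w (args' 1)) := by
  unfold GateEq
  rw [nodeVal_regate_eq, nodeVal_regate_eq, regate_arg_self, regate_arg_self, regate_op_self]

/-! #### Regime (a): an equivalent equation -/

/-- **Equivalent re-gating preserves the solutions**: if, whenever all other equations hold,
the new equation of `Q` is equivalent to the old one, then the two circuits have the same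
solutions. [folklore] -/
theorem consistent_regate_iff
    (heq : ∀ (x : Fin n → Bool) (w : Fin C.m → Bool), (∀ j, j ≠ Q → C.GateEq x w j) →
      (w Q = op' (C.nodeVal x w (args' 0)) (C.nodeVal x w (args' 1)) ↔ C.GateEq x w Q))
    (x : Fin n → Bool) (w : Fin C.m → Bool) : (C.regate Q op' args' h).Consistent x w ↔ C.Consistent x w := by
  constructor
  · intro hw
    have hother : ∀ j, j ≠ Q → C.GateEq x w j := fun j hj =>
      (C.gateEq_regate_iff_of_ne Q op' args' h x w hj).mp (hw j)
    intro j
    by_cases hj : j = Q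
    · rw [hj]; exact (heq x w hother).mp ((C.gateEq_regate_self_iff _ op' args' h x w).mp (hw Q))
    · exact hother j hj
  · intro hw
    have hother : ∀ j, j ≠ Q → C.GateEq x w j := fun j _ => hw j
    intro j
    by_cases hj : j = Q
    · rw [hj]; exact (C.gateEq_regate_self_iff _ op' args' h x w).mpr ((heq x w hother).mpr (hw Q))
    · exact (C.gateEq_regate_iff_of_ne Q op' args' h x w hj).mpr (hw j)

variable {C Q op' args' h} in
/-- Equivalent re-gating preserves fairness. [folklore] -/
theorem Fair.regate (hF : C.Fair)
    (heq : ∀ (x : Fin n → Bool) (w : Fin C.m → Bool), (∀ j, j ≠ Q → C.GateEq x w j) →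
      (w Q = op' (C.nodeVal x w (args' 0)) (C.nodeVal x w (args' 1)) ↔ C.GateEq x w Q)) :
    (C.regate Q op' args' h).Fair := fun x => by
  simp only [C.consistent_regate_iff Q op' args' h heq]
  exact hF x

/-! #### Regime (b): a gate of the acyclic part whose solutions satisfy the new equation -/

/-- The xor-part equations are unchanged by re-gating a gate of the acyclic part. [folklore] -/
theorem xorConsistent_regate_iff (hQ : Q ∉ C.xorPart) (x : Fin n → Bool) (w : Fin C.m → Bool) :
    (C.regate Q op' args' h).XorConsistent x w ↔ C.XorConsistent x w := by
  unfold XorConsistent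
  refine forall₂_congr fun j hj => ?_
  exact C.gateEq_regate_iff_of_ne Q op' args' h x w (fun hjQ => hQ (hjQ ▸ hj))

variable {C Q op' args' h} in
/-- Re-gating a gate of the acyclic part preserves fairness (the xor-part is unchanged, the
acyclic part evaluates). [folklore] -/
theorem Fair.regate_acyclic (hF : C.Fair) (hQ : Q ∉ C.xorPart) : (C.regate Q op' args' h).Fair := by
  refine fair_of_xorPart (fun x => ?_) fun x w w' hw hw' => ?_
  · obtain ⟨w, hw, -⟩ := hF x
    exact ⟨w, (C.xorConsistent_regate_iff Q op' args' h hQ x w).mpr (consistent_iff_xor_acyclic.mp hw).1⟩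
  · rw [C.xorConsistent_regate_iff Q op' args' h hQ] at hw hw'
    exact hF.xor_unique hw hw'

variable {C Q op' args' h} in
/-- A solution of `C` satisfying the new equation of `Q` solves the re-gated circuit. [folklore] -/
theorem Consistent.regate {x : Fin n → Bool} {w : Fin C.m → Bool} (hw : C.Consistent x w)
    (hQ : w Q = op' (C.nodeVal x w (args' 0)) (C.nodeVal x w (args' 1))) : (C.regate Q op' args' h).Consistent x w := by
  intro j
  by_cases hj : j = Q
  · rw [hj]; exact (C.gateEq_regate_self_iff _ op' args' h x w).mpr hQ
  · exact (C.gateEq_regate_iff_of_ne Q op' args' h x w hj).mpr (hw j)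

variable {C Q op' args' h} in
/-- **Under fairness, re-gating a gate of the acyclic part by an equation satisfied by every
solution preserves the solutions.** [folklore] -/
theorem consistent_regate_iff_acyclic (hF : C.Fair) (hQ : Q ∉ C.xorPart)
    (hsat : ∀ (x : Fin n → Bool) (w : Fin C.m → Bool), C.Consistent x w →
      w Q = op' (C.nodeVal x w (args' 0)) (C.nodeVal x w (args' 1)))
    (x : Fin n → Bool) (w : Fin C.m → Bool) : (C.regate Q op' args' h).Consistent x w ↔ C.Consistent x w := by
  constructor
  · intro hw
    obtain ⟨w₀, hw₀, -⟩ := hF x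
    have hw₀' : (C.regate Q op' args' h).Consistent x w₀ := hw₀.regate (hsat x w₀ hw₀)
    obtain ⟨w₁, -, huniq⟩ := hF.regate_acyclic (op' := op') (args' := args') (h := h) hQ x
    rw [huniq w hw, ← huniq w₀ hw₀']
    exact hw₀
  · intro hw
    exact hw.regate (hsat x w hw)

/-! #### Out-degrees, computing `f|_R` -/

/-- **Out-degrees after re-gating**: `Q`'s old wires are removed, its new wires added. [folklore] -/
theorem fanout_regate_add (u : Node n C.m) :
    (C.regate Q op' args' h).fanout u + (univ.filter fun a : Fin 2 => C.arg Q a = u).card =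
      C.fanout u + (univ.filter fun a : Fin 2 => args' a = u).card := by
  unfold fanout
  have key : ∀ j : Fin C.m, (univ.filter fun a : Fin 2 => (C.regate Q op' args' h).arg j a = u).card +
      (if j = Q then (univ.filter fun a : Fin 2 => C.arg Q a = u).card else 0) =
      (univ.filter fun a : Fin 2 => C.arg j a = u).card +
      (if j = Q then (univ.filter fun a : Fin 2 => args' a = u).card else 0) := by
    intro j
    by_cases hj : j = Q
    · simp only [hj, if_true]; omega
    · simp only [hj, if_false, add_zero]
  have hsum := sum_congr rfl fun j (_ : j ∈ (univ : Finset (Fin C.m))) => key j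
  rw [sum_add_distrib, sum_add_distrib, sum_ite_eq' univ Q, sum_ite_eq' univ Q] at hsum
  simpa using hsum

variable {C Q op' args' h} in
/-- **Re-gating keeps computing `f|_R`** when the solutions are preserved and the new variable
wires are to variables that were already read. [cite: LiYang2022, §3.3 (Rule 4), §4.1 (Case 0.3)] -/
theorem ComputesRestr.regate {f : (Fin n → ZMod 2) → Bool} {R : RdqSource n}
    (hC : C.ComputesRestr f R)
    (hcons : ∀ (x : Fin n → Bool) (w : Fin C.m → Bool), (C.regate Q op' args' h).Consistent x w ↔ C.Consistent x w)
    (hvars : ∀ (a : Fin 2) (i : Fin n), args' a = .var i → 1 ≤ C.fanout (.var i)) :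
    (C.regate Q op' args' h).ComputesRestr f R := by
  refine ⟨fun i hi => ?_, fun u hu w hw => ?_⟩
  · have h0 := hC.1 i hi
    have := C.fanout_regate_add Q op' args' h (.var i)
    have hnone : (univ.filter fun a : Fin 2 => args' a = .var i).card = 0 := by
      rw [card_eq_zero, filter_eq_empty_iff]
      intro a _ ha
      have := hvars a i ha
      omega
    omega
  · rw [hcons] at hw
    rw [nodeVal_regate_eq]
    exact hC.2 u hu w hw

end Regate

/-! ### Rule 4: useless gates -/

section Rule4

variable {C}
variable {G Q : Fin C.m} {aQ aG : Fin 2}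

/-- The merged function of Rule 4: `Q`'s function with its `G`-input expanded, as a function of
(`I₂` at position `aQ`, `I₁` at the other position), where `G` reads `I₁` at `aG` and `I₂` at the
other position. [cite: LiYang2022, §3.3 (Rule 4)] -/
def mergeOp (C : Semicircuit n) (G Q : Fin C.m) (aQ aG : Fin 2) : Bool → Bool → Bool := fun p q =>
  let v₂ := if aQ = 0 then p else q
  let v₁ := if aQ = 0 then q else p
  let g := if aG = 0 then C.op G v₁ v₂ else C.op G v₂ v₁
  if aQ = 0 then C.op Q g v₁ else C.op Q v₁ g

/-- The merged wires of Rule 4: `I₂` at position `aQ`, `I₁` kept at the other position.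
[cite: LiYang2022, §3.3 (Rule 4)] -/
def mergeArgs (C : Semicircuit n) (G Q : Fin C.m) (aQ aG : Fin 2) : Fin 2 → Node n C.m := fun a =>
  if a = aQ then C.arg G aG.rev else C.arg Q a

/-- The merged wires of Rule 4 inside the xor-part: `I₂` at position `aQ`, a constant at the
other. [cite: LiYang2022, §3.3 (Rule 4)] -/
def mergeArgsK (C : Semicircuit n) (G : Fin C.m) (aQ aG : Fin 2) (c : Bool) : Fin 2 → Node n C.m := fun a =>
  if a = aQ then C.arg G aG.rev else .const c

/-- In `Fin 2`, `p ≠ p.rev`. [folklore] -/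
theorem fin2_ne_rev : ∀ p : Fin 2, p ≠ p.rev := by decide

/-- In `Fin 2`, the point other than `p` is `p.rev`. [folklore] -/
theorem fin2_eq_rev_of_ne : ∀ {p a : Fin 2}, a ≠ p → a = p.rev := by decide

/-- A `1`-gate read by another gate does not read itself. [folklore] -/
theorem not_reads_self_of_fanout_eq_one (h1 : C.fanout (.gate G) = 1) (hGQ : G ≠ Q) (hQG : C.arg Q aQ = .gate G) :
    ∀ a, C.arg G a ≠ .gate G := by
  classical
  intro a ha
  unfold fanout at h1
  have hQ : 1 ≤ (univ.filter fun a' : Fin 2 => C.arg Q a' = .gate G).card :=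
    card_pos.mpr ⟨aQ, mem_filter.mpr ⟨mem_univ _, hQG⟩⟩
  have hG : 1 ≤ (univ.filter fun a' : Fin 2 => C.arg G a' = .gate G).card :=
    card_pos.mpr ⟨a, mem_filter.mpr ⟨mem_univ _, ha⟩⟩
  have := add_le_sum (f := fun j : Fin C.m => (univ.filter fun a' : Fin 2 => C.arg j a' = .gate G).card)
    (fun i _ => Nat.zero_le _) (mem_univ Q) (mem_univ G) hGQ.symm
  omega

/-- The other wire of the unique reader of a `1`-gate is not that gate. [folklore] -/
theorem arg_rev_ne_of_fanout_eq_one (h1 : C.fanout (.gate G) = 1) (hQG : C.arg Q aQ = .gate G) :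
    C.arg Q aQ.rev ≠ .gate G := by
  classical
  intro h
  unfold fanout at h1
  have hQ : 2 ≤ (univ.filter fun a' : Fin 2 => C.arg Q a' = .gate G).card := by
    have hsub : ({aQ, aQ.rev} : Finset (Fin 2)) ⊆ univ.filter fun a' : Fin 2 => C.arg Q a' = .gate G := by
      intro a ha
      rw [mem_insert, mem_singleton] at ha
      rcases ha with rfl | rfl
      · exact mem_filter.mpr ⟨mem_univ _, hQG⟩
      · exact mem_filter.mpr ⟨mem_univ _, h⟩
    have := card_le_card hsub
    rwa [card_pair (fin2_ne_rev aQ)] at this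
  have := single_le_sum (f := fun j : Fin C.m => (univ.filter fun a' : Fin 2 => C.arg j a' = .gate G).card)
    (fun i _ => Nat.zero_le _) (mem_univ Q)
  omega

/-- **In a fair semicircuit a useless configuration has no `2`-cycle inside the xor-part**:
if `Q` reads `G` and `I₁`, and `G` reads `I₁` and `Q`, both ⊕-type, the two gate equations
have the same linear part, so the xor-part self-map is not onto. [folklore] -/
theorem arg_rev_ne_reader_of_fair (hF : C.Fair) (hGK : G ∈ C.xorPart) (hQK : Q ∈ C.xorPart) (hGQ : G ≠ Q)
    (hQG : C.arg Q aQ = .gate G) (hshare : C.arg Q aQ.rev = C.arg G aG) : C.arg G aG.rev ≠ .gate Q := by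
  intro hGQ'
  obtain ⟨cQ, hcQ⟩ := C.isXorOp_of_mem Q hQK
  obtain ⟨cG, hcG⟩ := C.isXorOp_of_mem G hGK
  let x : Fin n → Bool := fun _ => false
  -- the two residuals always agree up to the constant `cQ ⊕ cG`
  have key : ∀ u : C.KVec, (C.xorMap x u ⟨Q, hQK⟩ ^^ C.xorMap x u ⟨G, hGK⟩) = (cQ ^^ cG) := by
    intro u
    -- the values of the wires
    have hvQa : C.nodeVal x (C.extendK u) (C.arg Q aQ) = u ⟨G, hGK⟩ := by
      rw [hQG]; exact C.extendK_apply_mem u hGK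
    have hvGa : C.nodeVal x (C.extendK u) (C.arg G aG.rev) = u ⟨Q, hQK⟩ := by
      rw [hGQ']; exact C.extendK_apply_mem u hQK
    have hsym : ∀ (op : Bool → Bool → Bool) (c : Bool), (∀ a b, op a b = ((a ^^ b) ^^ c)) →
        ∀ (p : Fin 2) (v : Fin 2 → Bool), op (v 0) (v 1) = ((v p ^^ v p.rev) ^^ c) := by
      intro op c hop p v
      rw [hop]
      obtain rfl | rfl : p = 0 ∨ p = 1 := by fin_cases p <;> simp
      · rfl
      · show ((v 0 ^^ v 1) ^^ c) = ((v 1 ^^ v 0) ^^ c); rw [Bool.xor_comm (v 0)]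
    unfold xorMap
    dsimp only
    rw [hsym _ _ hcQ aQ (fun a => C.nodeVal x (C.extendK u) (C.arg Q a)),
      hsym _ _ hcG aG (fun a => C.nodeVal x (C.extendK u) (C.arg G a))]
    rw [hvQa, hvGa, hshare]
    generalize u ⟨Q, hQK⟩ = q
    generalize u ⟨G, hGK⟩ = g
    generalize C.nodeVal x (C.extendK u) (C.arg G aG) = i
    cases q <;> cases g <;> cases i <;> cases cQ <;> cases cG <;> rfl
  -- hence the self-map misses a vector
  let target : C.KVec := fun k => if k = ⟨Q, hQK⟩ then !(cQ ^^ cG) else false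
  obtain ⟨u, hu⟩ := hF.xorMap_surjective x target
  have h1 : C.xorMap x u ⟨Q, hQK⟩ = !(cQ ^^ cG) := by rw [hu]; simp [target]
  have h2 : C.xorMap x u ⟨G, hGK⟩ = false := by
    rw [hu]
    show (if (⟨G, hGK⟩ : C.xorPart) = ⟨Q, hQK⟩ then !(cQ ^^ cG) else false) = false
    rw [if_neg (fun h => hGQ (congrArg Subtype.val h))]
  have := key u
  rw [h1, h2] at this
  revert this; cases cQ <;> cases cG <;> decide

/-! #### The merge analysis: `C' = (C.regate Q op' args').removeGate G` -/

section Merge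

variable (op' : Bool → Bool → Bool) (args' : Fin 2 → Node n C.m) (hOK : C.RegateOK Q op' args')
variable (hGQ : G ≠ Q) (hQG : C.arg Q aQ = .gate G) (hshare : C.arg Q aQ.rev = C.arg G aG)
  (h1 : C.fanout (.gate G) = 1)
  (hargs1 : args' aQ = C.arg G aG.rev) (hargs2 : args' aQ.rev = C.arg G aG ∨ ∃ c, args' aQ.rev = .const c)

include hQG h1 in
/-- Only `Q` is wired to `G`. [folklore] -/
theorem arg_ne_gate_of_ne (k : Fin C.m) (hk : k ≠ Q) (a : Fin 2) : C.arg k a ≠ .gate G := by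
  classical
  intro h
  unfold fanout at h1
  have hQ : 1 ≤ (univ.filter fun a' : Fin 2 => C.arg Q a' = .gate G).card :=
    card_pos.mpr ⟨aQ, mem_filter.mpr ⟨mem_univ _, hQG⟩⟩
  have hk' : 1 ≤ (univ.filter fun a' : Fin 2 => C.arg k a' = .gate G).card :=
    card_pos.mpr ⟨a, mem_filter.mpr ⟨mem_univ _, h⟩⟩
  have := add_le_sum (f := fun j : Fin C.m => (univ.filter fun a' : Fin 2 => C.arg j a' = .gate G).card)
    (fun i _ => Nat.zero_le _) (mem_univ Q) (mem_univ k) hk.symm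
  omega

include hGQ hQG h1 hargs1 hargs2 in
/-- After the merge no gate reads `G`. [folklore] -/
theorem not_reads_merge : ∀ k a, (C.regate Q op' args' hOK).arg k a ≠ .gate G := by
  intro k a
  rw [regate_arg]
  by_cases hk : k = Q
  · rw [if_pos hk]
    have hself := not_reads_self_of_fanout_eq_one h1 hGQ hQG
    rcases fin2_eq_or_eq_rev aQ a with rfl | rfl
    · rw [hargs1]; exact hself _
    · rcases hargs2 with h | ⟨c, h⟩
      · rw [h]; exact hself _
      · rw [h]; exact fun h' => by cases h'
  · rw [if_neg hk]; exact arg_ne_gate_of_ne hQG h1 k hk a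

variable {m' : ℕ} (ε : Fin m' ≃ {k : Fin C.m // k ≠ G})

include hGQ hQG hshare h1 hargs1 hargs2 in
/-- **Out-degrees after the merge**: nodes other than `G`, `I₁`, `I₂` (and constants) keep
their out-degree. [cite: LiYang2022, §3.3 (Rule 4)] -/
theorem fanout_merge_of_ne {u : Node n C.m} (huG : u ≠ .gate G) (hu1 : u ≠ C.arg G aG) (hu2 : u ≠ C.arg G aG.rev)
    (huc : ∀ c, u ≠ .const c) : ((C.regate Q op' args' hOK).removeGate G ε).fanout (u.skip G ε) = C.fanout u := by
  have h0 := not_reads_merge op' args' hOK hGQ hQG h1 hargs1 hargs2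
  have hA := (C.regate Q op' args' hOK).fanout_removeGate_add G ε h0 huG
  have hB := C.fanout_regate_add Q op' args' hOK u
  have hGargs : ∀ a, (C.regate Q op' args' hOK).arg G a ≠ u := by
    intro a; rw [regate_arg_of_ne _ _ _ _ _ hGQ]
    rcases fin2_eq_or_eq_rev aG a with rfl | rfl
    · exact fun h => hu1 h.symm
    · exact fun h => hu2 h.symm
  have hQargs : ∀ a, C.arg Q a ≠ u := by
    intro a
    rcases fin2_eq_or_eq_rev aQ a with rfl | rfl
    · rw [hQG]; exact fun h => huG h.symm
    · rw [hshare]; exact fun h => hu1 h.symm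
  have hargs : ∀ a, args' a ≠ u := by
    intro a
    rcases fin2_eq_or_eq_rev aQ a with rfl | rfl
    · rw [hargs1]; exact fun h => hu2 h.symm
    · rcases hargs2 with h | ⟨c, h⟩
      · rw [h]; exact fun h' => hu1 h'.symm
      · rw [h]; exact fun h' => huc c h'.symm
  rw [filter_eq_empty_iff.mpr (fun a _ => hGargs a), card_empty, add_zero] at hA
  rw [filter_eq_empty_iff.mpr (fun a _ => hQargs a), card_empty, add_zero,
    filter_eq_empty_iff.mpr (fun a _ => hargs a), card_empty, add_zero] at hB
  rw [hA, hB]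

include hGQ hQG hshare h1 hargs1 hargs2 in
/-- Out-degrees of variables do not grow along the merge. [cite: LiYang2022, §3.3 (Rule 4)] -/
theorem fanout_merge_var_le (i : Fin n) : ((C.regate Q op' args' hOK).removeGate G ε).fanout (.var i) ≤ C.fanout (.var i) := by
  classical
  have h0 := not_reads_merge op' args' hOK hGQ hQG h1 hargs1 hargs2
  have hA := (C.regate Q op' args' hOK).fanout_removeGate_var_add G ε h0 i
  have hB := C.fanout_regate_add Q op' args' hOK (.var i)
  -- every new wire of `Q` to `x_i` is matched by a removed wire
  have e3 : ∀ a, args' a = .var i → a = aQ →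
      1 ≤ (univ.filter fun a : Fin 2 => (C.regate Q op' args' hOK).arg G a = .var i).card := by
    rintro a ha rfl
    refine card_pos.mpr ⟨aG.rev, mem_filter.mpr ⟨mem_univ _, ?_⟩⟩
    rw [regate_arg_of_ne _ _ _ _ _ hGQ, ← hargs1, ha]
  have e4 : ∀ a, args' a = .var i → a = aQ.rev →
      1 ≤ (univ.filter fun a : Fin 2 => C.arg Q a = .var i).card := by
    rintro a ha rfl
    refine card_pos.mpr ⟨aQ.rev, mem_filter.mpr ⟨mem_univ _, ?_⟩⟩
    rcases hargs2 with h' | ⟨c, h'⟩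
    · rw [hshare, ← h', ha]
    · rw [h'] at ha; cases ha
  have hF2 : (univ.filter fun a : Fin 2 => args' a = .var i).card =
      (if args' aQ = .var i then 1 else 0) + (if args' aQ.rev = .var i then 1 else 0) := by
    rw [card_filter, Fin.sum_univ_two]
    obtain rfl | rfl : aQ = 0 ∨ aQ = 1 := by fin_cases aQ <;> simp
    · rfl
    · exact add_comm _ _
  have hq' : (if args' aQ = .var i then 1 else 0) ≤
      (univ.filter fun a : Fin 2 => (C.regate Q op' args' hOK).arg G a = .var i).card := by
    split_ifs with h
    · exact e3 _ h rfl
    · exact Nat.zero_le _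
  have hr' : (if args' aQ.rev = .var i then 1 else 0) ≤ (univ.filter fun a : Fin 2 => C.arg Q a = .var i).card := by
    split_ifs with h
    · exact e4 _ h rfl
    · exact Nat.zero_le _
  omega

include hGQ hQG hshare h1 hargs1 hargs2 in
/-- **New troubled gates after the merge are caused by `I₁` or by `I₂`.** [cite: LiYang2022, §3.3 (Rule 4), Lemma 3.11] -/
theorem causedBy_of_new_troubled_merge {k' : Fin m'}
    (hT' : ((C.regate Q op' args' hOK).removeGate G ε).Troubled k') (hT : ¬ C.Troubled (ε k')) :
    CausedBy C ((C.regate Q op' args' hOK).removeGate G ε) (fun k => (ε k : Fin C.m)) (C.arg G aG) k' ∨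
      CausedBy C ((C.regate Q op' args' hOK).removeGate G ε) (fun k => (ε k : Fin C.m)) (C.arg G aG.rev) k' := by
  classical
  by_cases hkQ : (ε k' : Fin C.m) = Q
  · -- `Q` itself: it reads `I₁` at `aQ.rev` (a constant wire would prevent troubledness)
    left
    obtain ⟨-, -, x, y, -, hr, -, -⟩ := hT'
    have hmem : ((C.regate Q op' args' hOK).removeGate G ε).arg k' aQ.rev ∈ Set.range (((C.regate Q op' args' hOK).removeGate G ε).arg k') := ⟨_, rfl⟩
    rw [hr] at hmem
    have hw : ((C.regate Q op' args' hOK).removeGate G ε).arg k' aQ.rev = (args' aQ.rev).skip G ε := by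
      rw [removeGate_arg, regate_arg, if_pos hkQ]
    rcases hargs2 with h | ⟨c, h⟩
    · rw [hw, h] at hmem
      rcases hmem with hm | hm
      · exact Or.inr ⟨x, (Node.skip_eq_var_iff G ε).mp hm, aQ.rev, by rw [hw, h]; exact hm⟩
      · exact Or.inr ⟨y, (Node.skip_eq_var_iff G ε).mp hm, aQ.rev, by rw [hw, h]; exact hm⟩
    · rw [hw, h] at hmem
      rcases hmem with hm | hm <;> cases hm
  · -- another gate: its wires and function are unchanged, so an out-degree near it changed
    by_contra hcon
    rw [not_or] at hcon
    obtain ⟨hc1, hc2⟩ := hcon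
    unfold CausedBy at hc1 hc2
    push Not at hc1 hc2
    have hargsk : (C.regate Q op' args' hOK).arg (ε k') = C.arg (ε k') := funext fun a => C.regate_arg_of_ne Q op' args' hOK hkQ a
    obtain ⟨hand, hf1, x, y, hxy, hr, hx, hy⟩ := hT'
    have hxr' : ∃ a', ((C.regate Q op' args' hOK).removeGate G ε).arg k' a' = .var x := by
      have : (Node.var x : Node n m') ∈ Set.range (((C.regate Q op' args' hOK).removeGate G ε).arg k') := by rw [hr]; simp
      exact this
    have hyr' : ∃ a', ((C.regate Q op' args' hOK).removeGate G ε).arg k' a' = .var y := by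
      have : (Node.var y : Node n m') ∈ Set.range (((C.regate Q op' args' hOK).removeGate G ε).arg k') := by rw [hr]; simp
      exact this
    rw [range_arg_removeGate_eq_pair_iff, hargsk] at hr
    have hopk : ((C.regate Q op' args' hOK).removeGate G ε).op k' = C.op (ε k') := by
      show (C.regate Q op' args' hOK).op (ε k') = _; rw [regate_op_of_ne _ _ _ _ _ hkQ]
    apply hT
    refine ⟨hopk ▸ hand, ?_, x, y, hxy, hr, ?_, ?_⟩
    · rw [← fanout_merge_of_ne op' args' hOK hGQ hQG hshare h1 hargs1 hargs2 ε (u := .gate (ε k' : Fin C.m))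
        (fun h => (ε k').2 (Node.gate.inj h)) (fun h => hc1.1 h.symm) (fun h => hc2.1 h.symm) (fun c h => by cases h)]
      simpa using hf1
    · obtain ⟨ax, hax⟩ := hxr'
      rw [← fanout_merge_of_ne op' args' hOK hGQ hQG hshare h1 hargs1 hargs2 ε (u := .var x) (by simp)
        (fun h => hc1.2 x h.symm ax hax) (fun h => hc2.2 x h.symm ax hax) (fun c h => by cases h)]
      simpa using hx
    · obtain ⟨ay, hay⟩ := hyr'
      rw [← fanout_merge_of_ne op' args' hOK hGQ hQG hshare h1 hargs1 hargs2 ε (u := .var y) (by simp)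
        (fun h => hc1.2 y h.symm ay hay) (fun h => hc2.2 y h.symm ay hay) (fun c h => by cases h)]
      simpa using hy

include hGQ hQG hshare h1 hargs1 hargs2 in
/-- **Rule 4 accounting**: `Φ' ≤ Φ + 2` for a suitable packing after the merge (the new troubled
gates are caused by `I₁` or `I₂`; if `G` was troubled — a `1`-gate on two `2`-variables — then
`I₁` becomes a `1`-variable and nothing new is troubled, compensating the pack of `G`).
[cite: LiYang2022, §3.3 (Rule 4), Lemma 3.11] -/
theorem exists_packing_merge {P : Finset (Fin C.m × Fin C.m)} (hP : C.IsPacking P) :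
    ∃ P' : Finset (Fin m' × Fin m'), ((C.regate Q op' args' hOK).removeGate G ε).IsPacking P' ∧ ((C.regate Q op' args' hOK).removeGate G ε).potential P' ≤ C.potential P + 2 := by
  classical
  let ι : Fin m' → Fin C.m := fun k => (ε k : Fin C.m)
  have hιinj : Function.Injective ι := fun k k' h => ε.injective (Subtype.ext h)
  have h0 := not_reads_merge op' args' hOK hGQ hQG h1 hargs1 hargs2
  -- drop the pack of `G`, if any
  let P₀ := P.filter fun p => p.1 ≠ G ∧ p.2 ≠ G
  have hP₀ : C.IsPacking P₀ := ⟨fun p hp => hP.1 p (mem_filter.mp hp).1,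
    fun p hp p' hp' hne => hP.2 p (mem_filter.mp hp).1 p' (mem_filter.mp hp').1 hne⟩
  have himg : ∀ p ∈ P₀, (∃ k, ι k = p.1) ∧ ∃ k, ι k = p.2 := by
    intro p hp
    obtain ⟨-, h1', h2'⟩ := mem_filter.mp hp
    exact ⟨⟨ε.symm ⟨p.1, h1'⟩, by simp [ι]⟩, ⟨ε.symm ⟨p.2, h2'⟩, by simp [ι]⟩⟩
  have hQT : ¬ C.Troubled Q := not_troubled_of_reads_gate hQG
  have hadj : ∀ k k', ((C.regate Q op' args' hOK).removeGate G ε).Troubled k → ((C.regate Q op' args' hOK).removeGate G ε).Troubled k' → C.Troubled (ι k) → C.Troubled (ι k') →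
      C.Adjacent (ι k) (ι k') → ((C.regate Q op' args' hOK).removeGate G ε).Adjacent k k' := by
    intro k k' _ _ hk hk' ⟨z, hz, hz'⟩
    have hkQ : ι k ≠ Q := fun h => hQT (h ▸ hk)
    have hkQ' : ι k' ≠ Q := fun h => hQT (h ▸ hk')
    refine ⟨z, ?_, ?_⟩
    · obtain ⟨a, ha⟩ := hz
      exact ⟨a, by rw [removeGate_arg, regate_arg_of_ne _ _ _ _ _ hkQ]; rw [show C.arg (ε k) a = .var z from ha]; rfl⟩
    · obtain ⟨a, ha⟩ := hz'
      exact ⟨a, by rw [removeGate_arg, regate_arg_of_ne _ _ _ _ _ hkQ']; rw [show C.arg (ε k') a = .var z from ha]; rfl⟩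
  let A : Finset (Fin m') := univ.filter fun k => ((C.regate Q op' args' hOK).removeGate G ε).Troubled k ∧ ¬ C.Troubled (ι k) ∧ CausedBy C ((C.regate Q op' args' hOK).removeGate G ε) ι (C.arg G aG) k
  let B : Finset (Fin m') := univ.filter fun k => ((C.regate Q op' args' hOK).removeGate G ε).Troubled k ∧ ¬ C.Troubled (ι k) ∧
    CausedBy C ((C.regate Q op' args' hOK).removeGate G ε) ι (C.arg G aG.rev) k
  have hAgood : ((C.regate Q op' args' hOK).removeGate G ε).GoodCover A :=
    goodCover_causedBy C ((C.regate Q op' args' hOK).removeGate G ε) ι hιinj _ A fun k hk => ⟨(mem_filter.mp hk).2.1, (mem_filter.mp hk).2.2.2⟩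
  have hBgood : ((C.regate Q op' args' hOK).removeGate G ε).GoodCover B :=
    goodCover_causedBy C ((C.regate Q op' args' hOK).removeGate G ε) ι hιinj _ B fun k hk => ⟨(mem_filter.mp hk).2.1, (mem_filter.mp hk).2.2.2⟩
  have hcover : ∀ k, ((C.regate Q op' args' hOK).removeGate G ε).Troubled k → ¬ C.Troubled (ι k) → k ∈ A ∨ k ∈ B := by
    intro k hk hkT
    rcases causedBy_of_new_troubled_merge op' args' hOK hGQ hQG hshare h1 hargs1 hargs2 ε hk hkT with h | h
    · exact Or.inl (mem_filter.mpr ⟨mem_univ _, hk, hkT, h⟩)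
    · exact Or.inr (mem_filter.mpr ⟨mem_univ _, hk, hkT, h⟩)
  obtain ⟨P', hP', hpot⟩ := exists_packing_transfer C ((C.regate Q op' args' hOK).removeGate G ε) ι hιinj hP₀ himg hadj A B hcover hAgood hBgood
  refine ⟨P', hP', hpot.trans ?_⟩
  have hA1 : ((if A = ∅ then 0 else 1 : ℕ) : ℝ) ≤ 1 := by exact_mod_cast ite_empty_le_one A
  have hB1 : ((if B = ∅ then 0 else 1 : ℕ) : ℝ) ≤ 1 := by exact_mod_cast ite_empty_le_one B
  by_cases hGT : C.Troubled G
  · -- `G` troubled: `I₁`, `I₂` are `2`-variables, `I₁` becomes a `1`-variable, nothing new is troubled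
    obtain ⟨-, -, z₁, z₂, p, hz12, hp, hprev, hf1, hf2⟩ := Troubled.exists_wires hGT
    have hI : ∃ i₁ i₂ : Fin n, i₁ ≠ i₂ ∧ C.arg G aG = .var i₁ ∧ C.arg G aG.rev = .var i₂ ∧
        C.fanout (.var i₁) = 2 ∧ C.fanout (.var i₂) = 2 := by
      rcases fin2_eq_or_eq_rev p aG with rfl | rfl
      · exact ⟨z₁, z₂, hz12, hp, hprev, hf1, hf2⟩
      · refine ⟨z₂, z₁, hz12.symm, hprev, ?_, hf2, hf1⟩; rw [Fin.rev_rev]; exact hp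
    obtain ⟨i₁, i₂, hi12, hI₁, hI₂, hfi₁, hfi₂⟩ := hI
    -- `x_{i₁}` is a `1`-variable afterwards
    have hfi₁' : ((C.regate Q op' args' hOK).removeGate G ε).fanout (.var i₁) ≤ 1 := by
      have hAa := (C.regate Q op' args' hOK).fanout_removeGate_var_add G ε h0 i₁
      have hBb := C.fanout_regate_add Q op' args' hOK (.var i₁)
      have hG1 : 1 ≤ (univ.filter fun a : Fin 2 => (C.regate Q op' args' hOK).arg G a = .var i₁).card :=
        card_pos.mpr ⟨aG, mem_filter.mpr ⟨mem_univ _, by rw [regate_arg_of_ne _ _ _ _ _ hGQ, hI₁]⟩⟩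
      have hQ1 : 1 ≤ (univ.filter fun a : Fin 2 => C.arg Q a = .var i₁).card :=
        card_pos.mpr ⟨aQ.rev, mem_filter.mpr ⟨mem_univ _, by rw [hshare, hI₁]⟩⟩
      have hargs1' : (univ.filter fun a : Fin 2 => args' a = .var i₁).card ≤ 1 := by
        have : (univ.filter fun a : Fin 2 => args' a = .var i₁) ⊆ {aQ.rev} := by
          intro a ha
          rw [mem_filter] at ha
          rw [mem_singleton]
          rcases fin2_eq_or_eq_rev aQ a with rfl | rfl
          · exfalso
            rw [hargs1, hI₂] at ha
            exact hi12 (Node.var.inj ha.2).symm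
          · rfl
        exact (card_le_card this).trans (by simp)
      rw [hfi₁] at hBb
      omega
    -- no new troubled gates
    have hnonew : ∀ k, ((C.regate Q op' args' hOK).removeGate G ε).Troubled k → ¬ C.Troubled (ι k) → False := by
      intro k hk hkT
      have hreads1 : ∀ a, ((C.regate Q op' args' hOK).removeGate G ε).arg k a ≠ .var i₁ := by
        intro a ha
        obtain ⟨-, -, x, y, -, hr, hx, hy⟩ := hk
        have hmem : ((C.regate Q op' args' hOK).removeGate G ε).arg k a ∈ Set.range (((C.regate Q op' args' hOK).removeGate G ε).arg k) := ⟨a, rfl⟩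
        rw [hr, ha] at hmem
        rcases hmem with hm | hm
        · rw [Node.var.injEq] at hm; rw [← hm] at hx; omega
        · rw [Set.mem_singleton_iff, Node.var.injEq] at hm; rw [← hm] at hy; omega
      rcases causedBy_of_new_troubled_merge op' args' hOK hGQ hQG hshare h1 hargs1 hargs2 ε hk hkT with h | h
      · rcases h with h | ⟨z, hz, a, ha⟩
        · rw [hI₁] at h; cases h
        · rw [hI₁, Node.var.injEq] at hz; subst hz; exact hreads1 a ha
      · rcases h with h | ⟨z, hz, a, ha⟩
        · rw [hI₂] at h; cases h
        · rw [hI₂, Node.var.injEq] at hz; subst hz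
          by_cases hkQ : ι k = Q
          · apply hreads1 aQ.rev
            rw [removeGate_arg, regate_arg, if_pos hkQ]
            rcases hargs2 with h' | ⟨c, h'⟩
            · rw [h', hI₁]; rfl
            · exfalso
              obtain ⟨-, -, x, y, -, hr, -, -⟩ := hk
              have hmem : ((C.regate Q op' args' hOK).removeGate G ε).arg k aQ.rev ∈ Set.range (((C.regate Q op' args' hOK).removeGate G ε).arg k) := ⟨_, rfl⟩
              rw [hr] at hmem
              have : ((C.regate Q op' args' hOK).removeGate G ε).arg k aQ.rev = .const c := by
                rw [removeGate_arg, regate_arg, if_pos hkQ, h']; rfl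
              rw [this] at hmem
              rcases hmem with hm | hm <;> cases hm
          · -- the other reader of `x_{i₂}`: unchanged surroundings
            have hargsk : (C.regate Q op' args' hOK).arg (ι k) = C.arg (ι k) := funext fun a' => C.regate_arg_of_ne Q op' args' hOK hkQ a'
            obtain ⟨hand, hf1', x, y, hxy, hr, hx, hy⟩ := hk
            have hxr' : ∃ a', ((C.regate Q op' args' hOK).removeGate G ε).arg k a' = .var x := by
              have : (Node.var x : Node n m') ∈ Set.range (((C.regate Q op' args' hOK).removeGate G ε).arg k) := by rw [hr]; simp
              exact this
            have hyr' : ∃ a', ((C.regate Q op' args' hOK).removeGate G ε).arg k a' = .var y := by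
              have : (Node.var y : Node n m') ∈ Set.range (((C.regate Q op' args' hOK).removeGate G ε).arg k) := by rw [hr]; simp
              exact this
            have hr' := hr
            rw [range_arg_removeGate_eq_pair_iff, hargsk] at hr'
            have hopk : ((C.regate Q op' args' hOK).removeGate G ε).op k = C.op (ι k) := by
              show (C.regate Q op' args' hOK).op (ε k) = _; rw [regate_op_of_ne _ _ _ _ _ hkQ]
            have hfk : ((C.regate Q op' args' hOK).removeGate G ε).fanout (.gate k) = C.fanout (.gate (ι k)) := by
              have := fanout_merge_of_ne op' args' hOK hGQ hQG hshare h1 hargs1 hargs2 ε (u := .gate (ι k))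
                (fun h => (ε k).2 (Node.gate.inj h)) (by rw [hI₁]; exact fun h => by cases h)
                (by rw [hI₂]; exact fun h => by cases h) (fun c h => by cases h)
              simpa [ι] using this
            have hfv : ∀ v : Fin n, (∃ a', ((C.regate Q op' args' hOK).removeGate G ε).arg k a' = .var v) → ((C.regate Q op' args' hOK).removeGate G ε).fanout (.var v) = 2 →
                C.fanout (.var v) = 2 := by
              intro v ⟨a', ha'⟩ hv2
              by_cases hv1 : v = i₁
              · subst hv1; exact absurd ha' (hreads1 a')
              by_cases hv2' : v = i₂
              · subst hv2'; exact hfi₂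
              have := fanout_merge_of_ne op' args' hOK hGQ hQG hshare h1 hargs1 hargs2 ε (u := .var v) (by simp)
                (by rw [hI₁]; exact fun h => hv1 (Node.var.inj h)) (by rw [hI₂]; exact fun h => hv2' (Node.var.inj h))
                (fun c h => by cases h)
              simp only [Node.skip_var] at this
              omega
            exact hkT ⟨hopk ▸ hand, hfk ▸ hf1', x, y, hxy, hr', hfv x hxr' hx, hfv y hyr' hy⟩
    have hAe : A = ∅ := filter_eq_empty_iff.mpr fun k _ ⟨hk, hkT, _⟩ => hnonew k hk hkT
    have hBe : B = ∅ := filter_eq_empty_iff.mpr fun k _ ⟨hk, hkT, _⟩ => hnonew k hk hkT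
    rw [hAe, hBe, if_pos rfl]
    -- `Φ(C, P₀) ≤ Φ(C, P) + 1`: at most one pack contains `G`
    have hcard : P.card ≤ P₀.card + 1 := by
      have hsub : P \ P₀ ⊆ P.filter fun p => p.1 = G ∨ p.2 = G := by
        intro p hp
        rw [mem_sdiff] at hp
        rw [mem_filter]
        refine ⟨hp.1, ?_⟩
        by_contra hno
        rw [not_or] at hno
        exact hp.2 (mem_filter.mpr ⟨hp.1, hno.1, hno.2⟩)
      have hone : (P.filter fun p => p.1 = G ∨ p.2 = G).card ≤ 1 := by
        refine card_le_one.mpr fun p hp p' hp' => ?_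
        rw [mem_filter] at hp hp'
        by_contra hne
        have hd := hP.2 p hp.1 p' hp'.1 hne
        rcases hp.2 with h | h <;> rcases hp'.2 with h' | h'
        · exact hd.1 (h.trans h'.symm)
        · exact hd.2.1 (h.trans h'.symm)
        · exact hd.2.2.1 (h.trans h'.symm)
        · exact hd.2.2.2 (h.trans h'.symm)
      have h3 := card_le_card hsub
      have h4 := card_sdiff_add_card_eq_card (filter_subset (fun p => p.1 ≠ G ∧ p.2 ≠ G) P)
      change (P \ P₀).card + P₀.card = P.card at h4
      omega
    unfold potential
    push_cast
    have : (P.card : ℝ) ≤ P₀.card + 1 := by exact_mod_cast hcard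
    linarith
  · -- `G` not troubled: `P₀ = P`
    have hPeq : P₀ = P := by
      refine filter_true_of_mem fun p hp => ?_
      obtain ⟨-, hT1, hT2, -⟩ := hP.1 p hp
      exact ⟨fun h => hGT (h ▸ hT1), fun h => hGT (h ▸ hT2)⟩
    rw [hPeq]
    linarith

include hGQ hQG hshare h1 hargs1 hargs2 in
/-- Influential inputs do not appear along the merge. [cite: LiYang2022, Def. 3.6] -/
theorem influential_merge_subset (R : RdqSource n) : ((C.regate Q op' args' hOK).removeGate G ε).influential R ⊆ C.influential R := by
  classical
  intro i hi
  unfold influential at hi ⊢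
  rw [mem_filter] at hi ⊢
  refine ⟨mem_univ _, hi.2.imp_left fun h => ?_⟩
  have := fanout_merge_var_le op' args' hOK hGQ hQG hshare h1 hargs1 hargs2 ε i
  omega

end Merge

/-! #### Rule 4 assembled -/

section Rule4Main

variable {f : (Fin n → ZMod 2) → Bool} {R : RdqSource n} {αφ αI : ℝ} {P : Finset (Fin C.m × Fin C.m)}

/-- An ⊕-type function evaluated on the two wires, read from any position. [folklore] -/
theorem xorOp_apply_eq {op : Bool → Bool → Bool} {c : Bool} (hop : ∀ a b, op a b = ((a ^^ b) ^^ c)) (p : Fin 2)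
    (v : Fin 2 → Bool) : op (v 0) (v 1) = ((v p ^^ v p.rev) ^^ c) := by
  rw [hop]
  obtain rfl | rfl : p = 0 ∨ p = 1 := by fin_cases p <;> simp
  · rfl
  · show ((v 0 ^^ v 1) ^^ c) = ((v 1 ^^ v 0) ^^ c); rw [Bool.xor_comm (v 0)]

/-- The constant of an ⊕-type function is its value at `(0, 0)`. [folklore] -/
theorem xorOp_const_eq {op : Bool → Bool → Bool} {c : Bool} (hop : ∀ a b, op a b = ((a ^^ b) ^^ c)) :
    op false false = c := by rw [hop]; cases c <;> rfl

/-- **Rule 4 data**: from the merged circuit to the conclusion. [cite: LiYang2022, Lemma 3.11 (Rule 4)] -/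
theorem rule4_of_merge (hF : C.Fair) (hC : C.ComputesRestr f R) (hP : C.IsPacking P) (hφ : 0 ≤ αφ) (hI : 0 ≤ αI)
    (αQ : ℝ) (op' : Bool → Bool → Bool) (args' : Fin 2 → Node n C.m) (hOK : C.RegateOK Q op' args')
    (hGQ : G ≠ Q) (hQG : C.arg Q aQ = .gate G) (hshare : C.arg Q aQ.rev = C.arg G aG) (h1 : C.fanout (.gate G) = 1)
    (hargs1 : args' aQ = C.arg G aG.rev) (hargs2 : args' aQ.rev = C.arg G aG ∨ ∃ c, args' aQ.rev = .const c)
    (hout : C.out ≠ .gate G)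
    (hcons : ∀ (x : Fin n → Bool) (w : Fin C.m → Bool), (C.regate Q op' args' hOK).Consistent x w ↔ C.Consistent x w) :
    ∃ (C' : Semicircuit n) (P' : Finset (Fin C'.m × Fin C'.m)), C'.Fair ∧ C'.ComputesRestr f R ∧
      C'.IsPacking P' ∧ C'.m + 1 = C.m ∧
      C'.measure αφ αI αQ P' R ≤ C.measure αφ αI αQ P R - (1 - 2 * αφ) := by
  have hFD : (C.regate Q op' args' hOK).Fair := fun x => by simp only [hcons]; exact hF x
  have hvars : ∀ (a : Fin 2) (i : Fin n), args' a = .var i → 1 ≤ C.fanout (.var i) := by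
    intro a i ha
    rcases fin2_eq_or_eq_rev aQ a with rfl | rfl
    · rw [hargs1] at ha; exact Nat.one_le_iff_ne_zero.mpr fun h0 => (fanout_eq_zero_iff C _).mp h0 G _ ha
    · rcases hargs2 with h | ⟨c, h⟩
      · rw [h] at ha; exact Nat.one_le_iff_ne_zero.mpr fun h0 => (fanout_eq_zero_iff C _).mp h0 G _ ha
      · rw [h] at ha; cases ha
  have hCD : (C.regate Q op' args' hOK).ComputesRestr f R := hC.regate hcons hvars
  have h0 := not_reads_merge op' args' hOK hGQ hQG h1 hargs1 hargs2
  let ε := (C.regate Q op' args' hOK).skipEquiv G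
  obtain ⟨P', hP', hpot⟩ := exists_packing_merge op' args' hOK hGQ hQG hshare h1 hargs1 hargs2 ε hP
  refine ⟨(C.regate Q op' args' hOK).removeGate G ε, P', hFD.removeGate ε h0, hCD.removeGate ε hFD h0 hout, hP',
    (C.regate Q op' args' hOK).removeGate_m_add_one G ε, ?_⟩
  have hinf : ((((C.regate Q op' args' hOK).removeGate G ε).influential R).card : ℝ) ≤ (C.influential R).card := by
    exact_mod_cast card_le_card (influential_merge_subset op' args' hOK hGQ hQG hshare h1 hargs1 hargs2 ε R)
  have hm : (((C.m - 1 : ℕ)) : ℝ) + 1 = C.m := by exact_mod_cast (C.regate Q op' args' hOK).removeGate_m_add_one G ε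
  unfold measure
  show ((C.m - 1 : ℕ) : ℝ) + _ + _ + _ ≤ _
  nlinarith [mul_le_mul_of_nonneg_left hinf hI, mul_le_mul_of_nonneg_left hpot hφ]

/-- **Rule 4 in the acyclic part**: `Q ∉ xorPart`. [cite: LiYang2022, Lemma 3.11 (Rule 4)] -/
theorem rule4_acyclic (hF : C.Fair) (hC : C.ComputesRestr f R) (hP : C.IsPacking P) (hφ : 0 ≤ αφ) (hI : 0 ≤ αI)
    (αQ : ℝ) (hGQ : G ≠ Q) (hQG : C.arg Q aQ = .gate G) (hshare : C.arg Q aQ.rev = C.arg G aG)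
    (h1 : C.fanout (.gate G) = 1) (hout : C.out ≠ .gate G) (hQK : Q ∉ C.xorPart) :
    ∃ (C' : Semicircuit n) (P' : Finset (Fin C'.m × Fin C'.m)), C'.Fair ∧ C'.ComputesRestr f R ∧
      C'.IsPacking P' ∧ C'.m + 1 = C.m ∧
      C'.measure αφ αI αQ P' R ≤ C.measure αφ αI αQ P R - (1 - 2 * αφ) := by
  have hOK : C.RegateOK Q (mergeOp C G Q aQ aG) (mergeArgs C G Q aQ aG) := by
    refine ⟨fun h => absurd h hQK, fun _ a k hk hkK ρ hρ => ?_⟩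
    unfold mergeArgs at hk
    by_cases ha : a = aQ
    · rw [if_pos ha] at hk
      by_cases hGK : G ∈ C.xorPart
      · exact absurd (C.mem_of_arg_eq G hGK _ k hk) hkK
      · exact (hρ G hGK _ k hk hkK).trans (hρ Q hQK aQ G hQG hGK)
    · rw [if_neg ha] at hk
      exact hρ Q hQK a k hk hkK
  have hargs1 : mergeArgs C G Q aQ aG aQ = C.arg G aG.rev := if_pos rfl
  have hargs2 : mergeArgs C G Q aQ aG aQ.rev = C.arg G aG ∨ ∃ c, mergeArgs C G Q aQ aG aQ.rev = .const c := by
    left; unfold mergeArgs; rw [if_neg (fin2_ne_rev aQ).symm, hshare]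
  refine rule4_of_merge hF hC hP hφ hI αQ _ _ hOK hGQ hQG hshare h1 hargs1 hargs2 hout fun x w => ?_
  refine C.consistent_regate_iff Q _ _ hOK (fun x w hother => ?_) x w
  -- the merged equation is the old one once the equation of `G` holds
  have hG : w G = C.op G (C.nodeVal x w (C.arg G 0)) (C.nodeVal x w (C.arg G 1)) := hother G hGQ
  suffices h : mergeOp C G Q aQ aG (C.nodeVal x w (mergeArgs C G Q aQ aG 0)) (C.nodeVal x w (mergeArgs C G Q aQ aG 1)) =
      C.op Q (C.nodeVal x w (C.arg Q 0)) (C.nodeVal x w (C.arg Q 1)) by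
    unfold GateEq; rw [h]
  have hvG : C.nodeVal x w (C.arg Q aQ) = w G := by rw [hQG]; rfl
  unfold mergeOp mergeArgs
  obtain rfl | rfl : aQ = 0 ∨ aQ = 1 := by fin_cases aQ <;> simp
  all_goals obtain rfl | rfl : aG = 0 ∨ aG = 1 := by fin_cases aG <;> simp
  all_goals simp only [if_true, if_false, show (1 : Fin 2) ≠ 0 from by decide, show (0 : Fin 2) ≠ 1 from by decide,
    show (0 : Fin 2).rev = 1 from rfl, show (1 : Fin 2).rev = 0 from rfl] at hshare hvG ⊢
  all_goals rw [hshare, ← hG, ← hvG]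

/-- **Rule 4 in the xor-part**: `Q ∈ xorPart` (then `G ∈ xorPart` and `Q = I₂ ⊕ c`).
[cite: LiYang2022, Lemma 3.11 (Rule 4)] -/
theorem rule4_xorPart (hF : C.Fair) (hC : C.ComputesRestr f R) (hP : C.IsPacking P) (hφ : 0 ≤ αφ) (hI : 0 ≤ αI)
    (αQ : ℝ) (hGQ : G ≠ Q) (hQG : C.arg Q aQ = .gate G) (hshare : C.arg Q aQ.rev = C.arg G aG)
    (h1 : C.fanout (.gate G) = 1) (hout : C.out ≠ .gate G) (hQK : Q ∈ C.xorPart) :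
    ∃ (C' : Semicircuit n) (P' : Finset (Fin C'.m × Fin C'.m)), C'.Fair ∧ C'.ComputesRestr f R ∧
      C'.IsPacking P' ∧ C'.m + 1 = C.m ∧
      C'.measure αφ αI αQ P' R ≤ C.measure αφ αI αQ P R - (1 - 2 * αφ) := by
  have hGK : G ∈ C.xorPart := C.mem_of_arg_eq Q hQK aQ G hQG
  obtain ⟨cQ, hcQ⟩ := C.isXorOp_of_mem Q hQK
  obtain ⟨cG, hcG⟩ := C.isXorOp_of_mem G hGK
  let c'' := C.op Q false false ^^ C.op G false false
  have hc'' : c'' = (cQ ^^ cG) := by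
    show (C.op Q false false ^^ C.op G false false) = _; rw [xorOp_const_eq hcQ, xorOp_const_eq hcG]
  let op' : Bool → Bool → Bool := fun p q => p ^^ q
  have hop'' : ∀ a b, op' a b = ((a ^^ b) ^^ false) := fun a b => (Bool.xor_false _).symm
  have hop' : IsXorOp op' := ⟨false, hop''⟩
  have hOK : C.RegateOK Q op' (mergeArgsK C G aQ aG c'') := by
    refine ⟨fun _ => ⟨hop', fun a k hk => ?_⟩, fun h => absurd hQK h⟩
    unfold mergeArgsK at hk
    by_cases ha : a = aQ
    · rw [if_pos ha] at hk; exact C.mem_of_arg_eq G hGK _ k hk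
    · rw [if_neg ha] at hk; cases hk
  have hargs1 : mergeArgsK C G aQ aG c'' aQ = C.arg G aG.rev := if_pos rfl
  have hargs2 : mergeArgsK C G aQ aG c'' aQ.rev = C.arg G aG ∨ ∃ c, mergeArgsK C G aQ aG c'' aQ.rev = .const c := by
    right; exact ⟨c'', by unfold mergeArgsK; rw [if_neg (fin2_ne_rev aQ).symm]⟩
  refine rule4_of_merge hF hC hP hφ hI αQ _ _ hOK hGQ hQG hshare h1 hargs1 hargs2 hout fun x w => ?_
  refine C.consistent_regate_iff Q _ _ hOK (fun x w hother => ?_) x w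
  have hG : w G = C.op G (C.nodeVal x w (C.arg G 0)) (C.nodeVal x w (C.arg G 1)) := hother G hGQ
  rw [xorOp_apply_eq hcG aG (fun a => C.nodeVal x w (C.arg G a))] at hG
  unfold GateEq
  rw [xorOp_apply_eq hcQ aQ (fun a => C.nodeVal x w (C.arg Q a)),
    xorOp_apply_eq hop'' aQ (fun a => C.nodeVal x w (mergeArgsK C G aQ aG c'' a))]
  have hv1 : C.nodeVal x w (C.arg Q aQ) = w G := by rw [hQG]; rfl
  have hv2 : C.nodeVal x w (mergeArgsK C G aQ aG c'' aQ) = C.nodeVal x w (C.arg G aG.rev) := by rw [hargs1]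
  have hv3 : C.nodeVal x w (mergeArgsK C G aQ aG c'' aQ.rev) = c'' := by
    unfold mergeArgsK; rw [if_neg (fin2_ne_rev aQ).symm]; rfl
  rw [hv1, hv2, hv3, hshare, hG, hc'']
  generalize C.nodeVal x w (C.arg G aG) = i₁
  generalize C.nodeVal x w (C.arg G aG.rev) = i₂
  constructor <;> intro h <;> rw [h] <;> cases i₁ <;> cases i₂ <;> cases cQ <;> cases cG <;> decide

/-- **Rule 4** (Li–Yang Lemma 3.11): "A gate is called useless if it is a `1`-gate with only
descendant `Q`, such that another input of `Q` also feeds `G`. We may eliminate `G` and rewire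
the nodes feeding it to feed `Q`." For `G ≠ Q` not the output, in either part of a fair
semicircuit computing `f|_R` with a packing: one gate fewer, `Δμ ≥ 1 - 2α_φ` (`ΔΦ ≤ 2`; the
paper's finer `ΔΦ ≤ 1` is not needed). [cite: LiYang2022, §3.3 (Rule 4), Lemma 3.11] -/
theorem rule4 (hF : C.Fair) (hC : C.ComputesRestr f R) (hP : C.IsPacking P) (hφ : 0 ≤ αφ) (hI : 0 ≤ αI)
    (αQ : ℝ) (hGQ : G ≠ Q) (hQG : C.arg Q aQ = .gate G) (hshare : C.arg Q aQ.rev = C.arg G aG)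
    (h1 : C.fanout (.gate G) = 1) (hout : C.out ≠ .gate G) :
    ∃ (C' : Semicircuit n) (P' : Finset (Fin C'.m × Fin C'.m)), C'.Fair ∧ C'.ComputesRestr f R ∧
      C'.IsPacking P' ∧ C'.m + 1 = C.m ∧
      C'.measure αφ αI αQ P' R ≤ C.measure αφ αI αQ P R - (1 - 2 * αφ) := by
  by_cases hQK : Q ∈ C.xorPart
  · exact rule4_xorPart hF hC hP hφ hI αQ hGQ hQG hshare h1 hout hQK
  · exact rule4_acyclic hF hC hP hφ hI αQ hGQ hQG hshare h1 hout hQK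

end Rule4Main

end Rule4

/-! ### Case 0.3, second half: a gate of the acyclic part depending on one input only -/

section SingleDependence

variable {C}
variable {f : (Fin n → ZMod 2) → Bool} {R : RdqSource n} {d : ℕ} {αφ αI : ℝ} {P : Finset (Fin C.m × Fin C.m)}
  {Q : Fin C.m} {a : Fin 2} {h : Bool → Bool}

/-- The function of a gate reduced to its dependence on the wire at position `a`. [cite: LiYang2022, §4.1 (Case 0.3)] -/
def depOp (a : Fin 2) (h : Bool → Bool) : Bool → Bool → Bool := fun p q => h (if a = 0 then p else q)

/-- `depOp` evaluated on the wires: the value at position `a`. [folklore] -/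
theorem depOp_apply (a : Fin 2) (h : Bool → Bool) (v : Fin 2 → Bool) : depOp a h (v 0) (v 1) = h (v a) := by
  unfold depOp
  obtain rfl | rfl : a = 0 ∨ a = 1 := by fin_cases a <;> simp
  · rw [if_pos rfl]
  · rw [if_neg (by decide)]

/-- `depOp` is not ∧-type (∧-type functions depend on both arguments). [folklore] -/
theorem not_isAndOp_depOp (a : Fin 2) (h : Bool → Bool) : ¬ IsAndOp (depOp a h) := by
  rintro ⟨c₁, c₂, c₃, hop⟩
  obtain rfl | rfl : a = 0 ∨ a = 1 := by fin_cases a <;> simp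
  · have h1 := hop (!c₁) false
    have h2 := hop (!c₁) true
    unfold depOp at h1 h2
    rw [if_pos rfl] at h1 h2
    rw [h1] at h2
    revert h2; cases c₁ <;> cases c₂ <;> cases c₃ <;> decide
  · have h1 := hop false (!c₂)
    have h2 := hop true (!c₂)
    unfold depOp at h1 h2
    rw [if_neg (by decide)] at h1 h2
    rw [h1] at h2
    revert h2; cases c₁ <;> cases c₂ <;> cases c₃ <;> decide

/-- **Eliminating a gate of the acyclic part whose value depends on one of its wires only**
(Li–Yang Case 0.3: "if there is a gate `G` fed by `I₁` and `I₂` that computes a function that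
only depends on `I₁`, we rewire the circuit such that `G` is fed by `I₁` and a constant `0` … We
can then make `G` degenerate by changing its function properly, so that `G` can be removed by
Rule 3. A gate is removed while `ΔΦ ≤ 2`, which means that `Δμ ≥ 1 - 2α_φ ≥ 0`"): here `Q ∉ xorPart`
with `w Q = h(value of the wire at position a)` on every solution; the function is first replaced
by `depOp a h` on the same wires (same solutions, same troubled gates but possibly `Q`), then
the other wire is rewired to a constant (`ΔΦ ≤ 1`), then Rules 2/3 apply (`Δμ ≥ 1 - α_φ`).
[cite: LiYang2022, §4.1 (Case 0.3), Lemma 3.11] -/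
theorem eliminate_single_dependence (hf : IsAffineDisperser f d) (hd : 2 * d + 2 ≤ R.dim) (hF : C.Fair)
    (hC : C.ComputesRestr f R) (hP : C.IsPacking P) (hφ : 0 ≤ αφ) (hI : 0 ≤ αI) (αQ : ℝ)
    (hQK : Q ∉ C.xorPart)
    (hdep : ∀ (x : Fin n → Bool) (w : Fin C.m → Bool), C.Consistent x w → w Q = h (C.nodeVal x w (C.arg Q a))) :
    ∃ (C' : Semicircuit n) (P' : Finset (Fin C'.m × Fin C'.m)), C'.Fair ∧ C'.ComputesRestr f R ∧
      C'.IsPacking P' ∧ C'.m + 1 = C.m ∧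
      C'.measure αφ αI αQ P' R ≤ C.measure αφ αI αQ P R - (1 - 2 * αφ) := by
  classical
  -- step 1: change the function of `Q` only
  have hOK : C.RegateOK Q (depOp a h) (C.arg Q) :=
    ⟨fun hK => absurd hK hQK, fun _ b k hk hkK ρ hρ => hρ Q hQK b k hk hkK⟩
  let D₁ := C.regate Q (depOp a h) (C.arg Q) hOK
  have hsat : ∀ (x : Fin n → Bool) (w : Fin C.m → Bool), C.Consistent x w →
      w Q = depOp a h (C.nodeVal x w (C.arg Q 0)) (C.nodeVal x w (C.arg Q 1)) := by
    intro x w hw; rw [depOp_apply a h (fun b => C.nodeVal x w (C.arg Q b))]; exact hdep x w hw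
  have hcons₁ : ∀ x w, D₁.Consistent x w ↔ C.Consistent x w := consistent_regate_iff_acyclic hF hQK hsat
  have hF₁ : D₁.Fair := hF.regate_acyclic hQK
  have hC₁ : D₁.ComputesRestr f R := hC.regate hcons₁ fun b i hb =>
    Nat.one_le_iff_ne_zero.mpr fun h0 => (fanout_eq_zero_iff C _).mp h0 Q b hb
  have hargs₁ : ∀ k, D₁.arg k = C.arg k := by
    intro k; funext b; rw [regate_arg]; split_ifs with hk
    · rw [hk]
    · rfl
  have hfan₁ : ∀ u, D₁.fanout u = C.fanout u := by
    intro u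
    show (∑ j, (univ.filter fun b : Fin 2 => D₁.arg j b = u).card) = ∑ j, (univ.filter fun b : Fin 2 => C.arg j b = u).card
    exact sum_congr rfl fun j _ => by rw [hargs₁]
  have hopQ₁ : D₁.op Q = depOp a h := regate_op_self _ _ _ _ _
  have hop₁ : ∀ k, k ≠ Q → D₁.op k = C.op k := fun k hk => regate_op_of_ne _ _ _ _ _ hk
  have hQT₁ : ¬ D₁.Troubled Q := by
    rintro ⟨hand, -⟩
    rw [hopQ₁] at hand
    exact not_isAndOp_depOp a h hand
  have hT₁ : ∀ k, D₁.Troubled k → C.Troubled k := by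
    intro k hk
    have hkQ : k ≠ Q := fun hkQ => hQT₁ (hkQ ▸ hk)
    obtain ⟨hand, h1, x, y, hxy, hr, hx, hy⟩ := hk
    rw [hop₁ k hkQ] at hand
    rw [hargs₁] at hr
    rw [hfan₁] at h1 hx hy
    exact ⟨hand, h1, x, y, hxy, hr, hx, hy⟩
  have hT₁' : ∀ k, k ≠ Q → C.Troubled k → D₁.Troubled k := by
    intro k hkQ ⟨hand, h1, x, y, hxy, hr, hx, hy⟩
    refine ⟨?_, ?_, x, y, hxy, ?_, ?_, ?_⟩
    · rw [hop₁ k hkQ]; exact hand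
    · rw [hfan₁]; exact h1
    · rw [hargs₁]; exact hr
    · rw [hfan₁]; exact hx
    · rw [hfan₁]; exact hy
  -- the packing minus the pack of `Q`
  let P₀ := P.filter fun p => p.1 ≠ Q ∧ p.2 ≠ Q
  have hP₀ : D₁.IsPacking P₀ := by
    refine ⟨fun p hp => ?_, fun p hp p' hp' hne => hP.2 p (mem_filter.mp hp).1 p' (mem_filter.mp hp').1 hne⟩
    obtain ⟨hpP, h1Q, h2Q⟩ := mem_filter.mp hp
    obtain ⟨hne, hT1, hT2, z, hz1, hz2⟩ := hP.1 p hpP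
    exact ⟨hne, hT₁' _ h1Q hT1, hT₁' _ h2Q hT2, z, by rw [hargs₁]; exact hz1, by rw [hargs₁]; exact hz2⟩
  have hpot₁ : D₁.potential P₀ ≤ C.potential P := by
    have hTsub : (univ.filter fun k => D₁.Troubled k) ⊆ (univ.filter fun k => C.Troubled k).erase Q := by
      intro k hk
      rw [mem_erase, mem_filter]
      have hk' := (mem_filter.mp hk).2
      exact ⟨fun hkQ => hQT₁ (hkQ ▸ hk'), mem_univ _, hT₁ k hk'⟩
    -- `#T(D₁) + [Q ∈ T(C)] ≤ #T(C)` and `|P| ≤ |P₀| + [Q ∈ T(C)]`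
    have hTle : D₁.troubledCount + (if C.Troubled Q then 1 else 0) ≤ C.troubledCount := by
      have h1 : D₁.troubledCount ≤ ((univ.filter fun k => C.Troubled k).erase Q).card := card_le_card hTsub
      by_cases hQT : C.Troubled Q
      · rw [if_pos hQT]
        have hmem : Q ∈ (univ.filter fun k => C.Troubled k) := mem_filter.mpr ⟨mem_univ _, hQT⟩
        have h2 : ((univ.filter fun k => C.Troubled k).erase Q).card + 1 = C.troubledCount := card_erase_add_one hmem
        omega
      · rw [if_neg hQT, add_zero]
        have h2 : ((univ.filter fun k => C.Troubled k).erase Q).card ≤ C.troubledCount := card_erase_le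
        omega
    have hPle : P.card ≤ P₀.card + (if C.Troubled Q then 1 else 0) := by
      by_cases hQT : C.Troubled Q
      · rw [if_pos hQT]
        have hsub : P \ P₀ ⊆ P.filter fun p => p.1 = Q ∨ p.2 = Q := by
          intro p hp
          rw [mem_sdiff] at hp
          rw [mem_filter]
          refine ⟨hp.1, ?_⟩
          by_contra hno
          rw [not_or] at hno
          exact hp.2 (mem_filter.mpr ⟨hp.1, hno.1, hno.2⟩)
        have hone : (P.filter fun p => p.1 = Q ∨ p.2 = Q).card ≤ 1 := by
          refine card_le_one.mpr fun p hp p' hp' => ?_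
          rw [mem_filter] at hp hp'
          by_contra hne
          have hdj := hP.2 p hp.1 p' hp'.1 hne
          rcases hp.2 with h | h <;> rcases hp'.2 with h' | h'
          · exact hdj.1 (h.trans h'.symm)
          · exact hdj.2.1 (h.trans h'.symm)
          · exact hdj.2.2.1 (h.trans h'.symm)
          · exact hdj.2.2.2 (h.trans h'.symm)
        have h3 := card_le_card hsub
        have h4 := card_sdiff_add_card_eq_card (filter_subset (fun p => p.1 ≠ Q ∧ p.2 ≠ Q) P)
        change (P \ P₀).card + P₀.card = P.card at h4
        omega
      · rw [if_neg hQT, add_zero]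
        have hPeq : P₀ = P := by
          refine filter_true_of_mem fun p hp => ?_
          obtain ⟨-, hT1, hT2, -⟩ := hP.1 p hp
          exact ⟨fun h => hQT (h ▸ hT1), fun h => hQT (h ▸ hT2)⟩
        rw [hPeq]
    unfold potential
    have e1 : (D₁.troubledCount : ℝ) + (if C.Troubled Q then 1 else 0 : ℕ) ≤ C.troubledCount := by exact_mod_cast hTle
    have e2 : (P.card : ℝ) ≤ P₀.card + (if C.Troubled Q then 1 else 0 : ℕ) := by exact_mod_cast hPle
    linarith
  -- step 2: rewire the ignored wire of `Q` to the constant `false`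
  let D₂ := D₁.rewireConst Q a.rev false
  have hF₂ : D₂.Fair := hF₁.rewireConst hQK false
  have hcons₂ : ∀ x w, D₂.Consistent x w ↔ D₁.Consistent x w := by
    intro x w
    -- the equation of `Q` does not see the wire at `a.rev`
    have key : ∀ k, D₂.GateEq x w k ↔ D₁.GateEq x w k := by
      intro k
      unfold GateEq
      rw [nodeVal_rewireConst_eq, nodeVal_rewireConst_eq, rewireConst_arg, rewireConst_arg]
      by_cases hk : k = Q
      · rw [hk, hopQ₁]
        rw [depOp_apply a h (fun b => D₁.nodeVal x w (if Q = Q ∧ b = a.rev then .const false else D₁.arg Q b)),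
          depOp_apply a h (fun b => D₁.nodeVal x w (D₁.arg Q b))]
        rw [if_neg (fun h' => fin2_ne_rev a h'.2)]
      · rw [if_neg (fun h' => hk h'.1), if_neg (fun h' => hk h'.1)]
    exact forall_congr' key
  have hC₂ : D₂.ComputesRestr f R := by
    refine ⟨fun i hi => ?_, fun u hu w hw => ?_⟩
    · have h0 := hC₁.1 i hi
      have := D₁.fanout_rewireConst_add Q a.rev false (.var i) (fun b h => by cases h)
      show (D₁.rewireConst Q a.rev false).fanout (.var i) = 0
      omega
    · rw [hcons₂] at hw
      rw [nodeVal_rewireConst_eq]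
      exact hC₁.2 u hu w hw
  obtain ⟨P₂, hP₂, hpot₂⟩ := D₁.exists_packing_rewireConst Q a.rev false hP₀
  have h₀ : D₂.arg Q a.rev = .const false := by rw [rewireConst_arg, if_pos ⟨rfl, rfl⟩]
  have hself₂ : ∀ b, D₂.arg Q b ≠ .gate Q := by
    intro b
    rw [rewireConst_arg]
    split_ifs
    · exact fun h' => by cases h'
    · show D₁.arg Q b ≠ .gate Q
      rw [hargs₁]; exact C.arg_ne_self_of_not_mem hQK b
  -- step 3: Rules 2/3
  obtain ⟨C', P', hF', hC', hP', hm, hμ⟩ := rule23_any (C := D₂) hf hd hF₂ hC₂ hP₂ h₀ hself₂ hφ hI αQ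
  refine ⟨C', P', hF', hC', hP', hm, hμ.trans ?_⟩
  -- `μ(D₂, P₂) ≤ μ(C, P) + α_φ`
  have hinf₂ : ((D₂.influential R).card : ℝ) ≤ (C.influential R).card := by
    have h1 := D₁.influential_rewireConst_subset Q a.rev false R
    have h2 : D₁.influential R = C.influential R := by
      unfold influential; simp only [hfan₁]
    rw [h2] at h1
    exact_mod_cast card_le_card h1
  have hpot : D₂.potential P₂ ≤ C.potential P + 1 := hpot₂.trans (by linarith)
  unfold measure
  show (C.m : ℝ) + _ + _ + _ - _ ≤ _
  nlinarith [mul_le_mul_of_nonneg_left hinf₂ hI, mul_le_mul_of_nonneg_left hpot hφ]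

end SingleDependence

end Semicircuit

end Literature.Computability.Complexity
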